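import Summits.NavierStokesRegularity.NavierStokesRegularity.Theorems.FrozenSignCascadeBoundedEnvelopeContinuationLiouvilleAxisymmetricHolds
import Summits.NavierStokesRegularity.NavierStokesRegularity.Theorems.FrozenSignCascadeBoundedEnvelopeContinuationMorreyOfPMDual
import HarnessLib

/-!
# Route FrozenSignCascade · crux `BoundedEnvelopeContinuation` — the open stub (L_PM2) of reshape r5
# holds in the axisymmetric class

Helper file for the crux item stmt-NavierStokesRegularity-10579 (`BoundedEnvelopeContinuation`,
conjunct (B) of route `FrozenSignCascade`), line `registered`; lands `--supports` that item
(registered sub-goal `liouvillePM2_axisymmetric`; lead c5).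

After reshape r5 the one open stub of the line is (L_PM2): a bounded ancient mild solution
(`ν = 1`), jointly smooth and Oseen-mild on `(-∞,0) × ℝ³`, with the dual pseudo-measure bound
`|∫ v_l(t) φ| ≤ C' ∫ ‖𝓕φ‖/‖ξ‖²` at all negative times, vanishes. Lead c4 proved the Morrey form
(L_M) in the AXISYMMETRIC class (`liouvilleMorrey_axisymmetric`: Seregin–Šverák axis decay from
the Albritton–Barker Type-I quantity, un-zoomed at all scales, and KNSS 2009 Thm 5.3); since the
dual `PM²` bound supplies the Morrey bound (`stub_morreyOfPMDual`, `PM² ⊂ Ṁ^{2,1}`), (L_PM2)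
holds verbatim for axisymmetric `v`. Together with `liouvillePM2_small` (small constant) and
`liouvillePM2_of_smallPast` (small constant on some past) these are the regimes in which the
open stub is a tree theorem.

References: G. Koch, N. Nadirashvili, G. Seregin, V. Šverák, Acta Math. 203 (2009), Thm 5.3;
G. Seregin, V. Šverák, Comm. PDE 34 (2009), Thm 3.2; P. G. Lemarié-Rieusset, *The Navier–Stokes
problem in the 21st century* (2016), §8.5.
-/

noncomputable section

set_option linter.dupNamespace false -- nested layout Summit.<S>.<Sub>, Sub = S (D-0017)

open Set MeasureTheory Function
open Literature.Analysis Literature.Analysis.FluidPDE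

namespace Summit.NavierStokesRegularity.NavierStokesRegularity.Theorems.BoundedEnvelope

/-- **(L_PM2) in the axisymmetric class** (registered sub-goal): a bounded ancient mild solution
(`ν = 1`), jointly smooth and Oseen-mild on `(-∞,0) × ℝ³`, whose slices obey the dual `PM²` bound
at all negative times and are axisymmetric, vanishes identically (`liouvilleMorrey_axisymmetric`
of lead c4 fed with the Morrey bound that `stub_morreyOfPMDual` extracts from the `PM²` bound).
[cite: KochNadirashviliSereginSverak2009, Thm. 5.3; LemarieRieusset2016, §8.5] -/
theorem liouvillePM2_axisymmetric :
    ∀ v : ℝ → EuclideanSpace ℝ (Fin 3) → EuclideanSpace ℝ (Fin 3),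
      Literature.Analysis.FluidPDE.IsBoundedAncientMildSolution 1 v →
      ContDiffOn ℝ (⊤ : ℕ∞) (uncurry v) (Set.Iio 0 ×ˢ Set.univ) →
      (∀ s t : ℝ, s < t → t < 0 → ∀ x,
        v t x = UnboundedOperators.heatExtension (v s) (t - s) x -
          Literature.Analysis.FluidPDE.oseenDuhamel 1 s v v t x) →
      (∃ C' : ℝ, ∀ t < 0, ∀ (l : Fin 3) (φ : EuclideanSpace ℝ (Fin 3) → ℝ),
        MeasureTheory.Integrable φ →
        MeasureTheory.Integrable (fun ξ : EuclideanSpace ℝ (Fin 3) =>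
          ‖FourierTransform.fourier (fun x => (φ x : ℂ)) ξ‖ / ‖ξ‖ ^ 2) →
        |∫ y, v t y l * φ y| ≤
          C' * ∫ ξ : EuclideanSpace ℝ (Fin 3), ‖FourierTransform.fourier (fun x => (φ x : ℂ)) ξ‖ / ‖ξ‖ ^ 2) →
      (∀ t < 0, Literature.Analysis.FluidPDE.IsAxisymmetric (v t)) →
      ∀ t < 0, ∀ x, v t x = 0 :=
  fun v hv hsm hoseen hPM hax =>
    liouvilleMorrey_axisymmetric v hv hsm hoseen (stub_morreyOfPMDual v hv hsm hPM) hax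

end Summit.NavierStokesRegularity.NavierStokesRegularity.Theorems.BoundedEnvelope

end
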